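import Literature.NumberTheory.Transcendental.PeriodsWave0
import HarnessLib

/-!
# Zudilin's general well-poised linear forms in `1` and odd zeta values: the denominator lemma (Lemma 19) for every `𝐡`

Topic `Literature/NumberTheory/Irrationality/Zudilin2004`. Typed, cited statement (one named fact, no proof,
D-0014) from W. Zudilin, *Arithmetic of linear forms involving odd zeta values*, J. Théor. Nombres Bordeaux
**16** (2004) 251–291 = arXiv:math/0206176 [Zudilin2004], §8 « Linear forms in 1 and odd zeta values »,
(8.1)–(8.9) and **Lemma 19**, for a GENERAL parameter set `𝐡 = (h₀; h₁, …, h_q)`. PRIMARY SOURCE read on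
the page (held arXiv text `paper:arxiv-math_0206176`, pp. 19–20; the journal scan `paper:doi-10-5802-jtnb-447`
pp. 280–282 has no legible formulas). The tree PROVES this lemma at the parameters of Theorem 3
(`r = 3`, `q = 13`, `h₀ = 91n+2`, `h₁ = h₂ = h₃ = 27n+1`, `h_j = (25+j)n+1`):
`Literature/NumberTheory/Transcendental/ZudilinLemma19.lean` (`Transcendental.Zudilin2004.qZeta_integral`,
`qConst_integral`, with `R`, `S`, `nu`, `nuMin`, `Phi`, `D` of `ZudilinOddZeta.lean`), and the cell pub-zeta5
instantiates it for the dual series `F̃₇(b)` (`Summits/…/Zeta5Search/DualSeriesLemma19*.lean`); what was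
missing is the PARAMETRIC statement (cell zeta5-irr, zi-p2 `LEMMAS.md` A1/A2: « parametric assembly
MISSING »; zi-lit `LIT-ZI.md` D1). HONEST FRAMING (inherited): systematic search; no irrationality claim
unless certified — Lemma 19 is an integrality statement about the coefficients of a linear form.

§8 [cite: Zudilin2004, §8 (8.1)–(8.9), Lemma 19 (arXiv pp. 19–20; journal pp. 280–281)]: "Consider positive odd
integers `q` and `r`, where `q ≥ r+4`. To a set of integral positive parameters `𝐡 = (h₀;h₁,…,h_q)` satisfying the
condition `h₁ + h₂ + ⋯ + h_q ≤ h₀·(q−r)/2` (8.1) we assign the rational function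
`R̃(t) := (h₀+2t) Γ(h₀+t)^r Γ(h₁+t)⋯Γ(h_q+t) / (Γ(1+t)^r Γ(1+h₀−h₁+t)⋯Γ(1+h₀−h_q+t))` (8.2). …
`F̃(𝐡) := (1/(r−1)!) Σ_{t=0}^∞ R̃^{(r−1)}(t)` (8.4) … To present this result explicitly we require the ordering
`h₁ ≤ h₂ ≤ ⋯ ≤ h_q < h₀/2` and the following arithmetic normalization of (8.4):
`F(𝐡) := ∏_{j=r+1}^q (h₀−2h_j)! / ∏_{j=1}^r (h_j−1)!² · F̃(𝐡) = (1/(r−1)!) Σ_{t=1−h₁}^∞ R^{(r−1)}(t)` (8.6),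
where the rational function
`R(t) := ∏_{j=1}^r (1/(h_j−1)!) Γ(h_j+t)/Γ(1+t) · ∏_{j=1}^r (1/(h_j−1)!) Γ(h₀+t)/Γ(1+h₀−h_j+t)
        · ∏_{j=r+1}^q (h₀−2h_j)! Γ(h_j+t)/Γ(1+h₀−h_j+t)` (8.7)
is the product of elementary bricks (7.3). Set `m₀ = max{h_r−1, h₀−2h_{r+1}}` and
`m_j = max{m₀, h₀−h₁−h_{r+j}}` for `j = 1,…,q−r`, and define the integral quantity
`Φ = Φ(𝐡) := ∏_{√h₀ < p ≤ m_{q−r}} p^{ν_p}` (8.8), where `ν_p := min_{h_{r+1} ≤ k ≤ h₀−h_{r+1}} {ν_{k,p}}` (8.9) and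
`ν_{k,p} := Σ_{j=1}^r ([(k−1)/p] + [(h₀−k−1)/p] − [(k−h_j)/p] − [(h₀−h_j−k)/p] − 2[(h_j−1)/p])
          + Σ_{j=r+1}^q ([(h₀−2h_j)/p] − [(k−h_j)/p] − [(h₀−h_j−k)/p])`.
In this notation the result reads as follows. **Lemma 19.** The quantity (8.6) is a linear form in
`1, ζ(r+2), ζ(r+4), …, ζ(q−4), ζ(q−2)` with rational coefficients; moreover,
`D_{m₁}^r D_{m₂} ⋯ D_{m_{q−r}} · Φ^{−1} · F(𝐡) ∈ ℤζ(q−2) + ℤζ(q−4) + ⋯ + ℤζ(r+2) + ℤ`."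

RENDERING (tree vocabulary; no notion re-declared).
* `HParams = (q, r, h)` with `h : ℕ → ℕ` read at `0,…,q`; `HParams.Valid` = the standing hypotheses of §8
  quoted above (odd `q, r`, `q ≥ r+4`, `h_j ≥ 1`, (8.1), the ordering `h₁ ≤ ⋯ ≤ h_q < h₀/2`).
* `Rwp P t` is the rational function of (8.6)–(8.7) as a real function, the Gamma quotients written as the
  finite products they are for integer `𝐡` (`Γ(h_j+t)/Γ(1+t) = ∏_{i=1}^{h_j−1}(t+i)`,
  `Γ(h₀+t)/Γ(1+h₀−h_j+t) = ∏_{i=1}^{h_j−1}(t+h₀−h_j+i)`, `Γ(h_j+t)/Γ(1+h₀−h_j+t) = 1/∏_{i=0}^{h₀−2h_j}(t+h_j+i)`),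
  INCLUDING the well-poised factor `(h₀+2t)` of (8.2): the display (8.7) of the arXiv text omits it, but the
  definition (8.6) `F = (∏(h₀−2h_j)!/∏(h_j−1)!²)·F̃` forces it (the zeros of order `r` of `R̃` at
  `t = −1,…,1−h₁` make the two summation ranges agree), and this is how both Fischler (Sém. Bourbaki 910, §3.3)
  and the tree's Theorem-3 instance `Transcendental.Zudilin2004.R` (factor `37n + 2k`, `k = t + h₁`) read it.
* `Fwp P = (1/(r−1)!) Σ_{t ≥ 1−h₁} R^{(r−1)}(t)` with `iteratedDeriv` and a real `tsum` over `t = n + 1 − h₁`,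
  `n : ℕ` (as in `Transcendental.Zudilin2004.S`).
* The brackets `[·]` of (8.9) are integer parts of possibly negative rationals, typed `⌊(· : ℚ)/p⌋`
  (`Int.floor`) exactly as in `Transcendental.Zudilin2004.nu`; `ν_p ≥ 0` (each bracket group is a
  superadditivity defect), `Φ = ∏ p^{ν_p}` over the primes `p ≤ m_{q−r}` with `p² > h₀`; `D_N = Nat.lcmUpto N`;
  `ζ(j) = Transcendental.zetaValue j`. The conclusion is typed multiplied through by `Φ`:
  `D_{m₁}^r D_{m₂}⋯D_{m_{q−r}} · F(𝐡) = Φ · (Z₀ + Σ_{j ∈ {r+2, r+4, …, q−2}} Z_j ζ(j))`, `Z_j ∈ ℤ`.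
Sanity check of the transcription at the Theorem-3 parameters: `m₀ = 33n`, `(m₁, m₂, m₃,…,m₁₀) =
(35n, 34n, 33n, …, 33n)` (so `D_{m₁}³D_{m₂}⋯D_{m₁₀} = D_{35n}³ D_{34n} D_{33n}⁸`), `ν_p` minimised over
`29n+1 ≤ k ≤ 62n+1`, `Φ` over `√(91n+2) < p ≤ 33n` — the tree's `D`, `nuMin`, `Phi`.
NOT here: Lemma 20 (saddle-point asymptotics, `r = 3`), Proposition 5 and Theorem 3 (the tree's
`Transcendental.zudilin`, PROVED modulo the decay of Lemma 20 in `ZudilinReduction.lean`), the §9 conjecture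
on one `lcm` factor fewer (OPEN; not literature).
-/

noncomputable section

open Finset

namespace Literature.NumberTheory.Irrationality.Zudilin2004

open Literature.NumberTheory.Transcendental (zetaValue)

/-! ### Parameters -/

/-- A parameter set of §8: odd `q ≥ r + 4`, and `𝐡 = (h₀; h₁, …, h_q)` read from `h : ℕ → ℕ` at `0,…,q`.
[cite: Zudilin2004, §8 (8.1)] -/
structure HParams where
  /-- the odd integer `q` (number of lower parameters) -/
  q : ℕ
  /-- the odd integer `r` (order of differentiation is `r − 1`) -/
  r : ℕ
  /-- `h 0 = h₀`, `h j = h_j` (`1 ≤ j ≤ q`) -/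
  h : ℕ → ℕ

namespace HParams

/-- The standing hypotheses of §8: `q, r` positive odd with `q ≥ r+4`; `h₀, …, h_q ≥ 1`;
(8.1) `h₁ + ⋯ + h_q ≤ h₀ (q−r)/2`; the ordering `h₁ ≤ h₂ ≤ ⋯ ≤ h_q < h₀/2`.
[cite: Zudilin2004, §8 (8.1) and the ordering before (8.6)] -/
def Valid (P : HParams) : Prop :=
  Odd P.q ∧ Odd P.r ∧ P.r + 4 ≤ P.q ∧ (∀ j ∈ Finset.Icc 0 P.q, 1 ≤ P.h j) ∧
    2 * (∑ j ∈ Finset.Icc 1 P.q, P.h j) ≤ P.h 0 * (P.q - P.r) ∧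
    (∀ j ∈ Finset.Icc 1 (P.q - 1), P.h j ≤ P.h (j + 1)) ∧ 2 * P.h P.q < P.h 0

/-- The rational function `R(t)` of (8.6)–(8.7) (with the well-poised factor `h₀ + 2t` of (8.2), see the module
docstring), as a real function:
`(h₀+2t) · ∏_{j≤r} [∏_{i=1}^{h_j−1}(t+i)/(h_j−1)!] · ∏_{j≤r} [∏_{i=1}^{h_j−1}(t+h₀−h_j+i)/(h_j−1)!]
 · ∏_{j=r+1}^{q} (h₀−2h_j)!/∏_{i=0}^{h₀−2h_j}(t+h_j+i)`.
[cite: Zudilin2004, §8 (8.2), (8.6)–(8.7)] -/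
def Rwp (P : HParams) (t : ℝ) : ℝ :=
  ((P.h 0 : ℝ) + 2 * t) *
    (∏ j ∈ Finset.Icc 1 P.r, (∏ i ∈ Finset.Icc 1 (P.h j - 1), (t + i)) / ((P.h j - 1).factorial : ℝ)) *
    (∏ j ∈ Finset.Icc 1 P.r,
      (∏ i ∈ Finset.Icc 1 (P.h j - 1), (t + ((P.h 0 - P.h j : ℕ) : ℝ) + i)) / ((P.h j - 1).factorial : ℝ)) *
    ∏ j ∈ Finset.Icc (P.r + 1) P.q,
      ((P.h 0 - 2 * P.h j).factorial : ℝ) / ∏ i ∈ Finset.Icc 0 (P.h 0 - 2 * P.h j), (t + P.h j + i)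

/-- The linear form `F(𝐡) = (1/(r−1)!) Σ_{t=1−h₁}^{∞} R^{(r−1)}(t)` of (8.6) (real `tsum` over `t = n + 1 − h₁`,
`n ∈ ℕ`). [cite: Zudilin2004, §8 (8.6)] -/
def Fwp (P : HParams) : ℝ :=
  (1 / ((P.r - 1).factorial : ℝ)) *
    ∑' n : ℕ, iteratedDeriv (P.r - 1) (Rwp P) ((n : ℝ) + 1 - P.h 1)

/-- `m₀ = max{h_r − 1, h₀ − 2h_{r+1}}`. [cite: Zudilin2004, §8 (before (8.8))] -/
def m0 (P : HParams) : ℕ := max (P.h P.r - 1) (P.h 0 - 2 * P.h (P.r + 1))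

/-- `m_j = max{m₀, h₀ − h₁ − h_{r+j}}` (`j = 1,…,q−r`). [cite: Zudilin2004, §8 (before (8.8))] -/
def mSeq (P : HParams) (j : ℕ) : ℕ := max P.m0 (P.h 0 - P.h 1 - P.h (P.r + j))

/-- The bracket sum `ν_{k,p}` of (8.9) (integer parts `[x] = ⌊x⌋` of rationals).
[cite: Zudilin2004, §8 (8.9)] -/
def nuKP (P : HParams) (k p : ℕ) : ℤ :=
  (∑ j ∈ Finset.Icc 1 P.r,
      (⌊((k : ℚ) - 1) / p⌋ + ⌊((P.h 0 : ℚ) - k - 1) / p⌋ - ⌊((k : ℚ) - P.h j) / p⌋ -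
        ⌊((P.h 0 : ℚ) - P.h j - k) / p⌋ - 2 * ⌊((P.h j : ℚ) - 1) / p⌋)) +
    ∑ j ∈ Finset.Icc (P.r + 1) P.q,
      (⌊((P.h 0 : ℚ) - 2 * P.h j) / p⌋ - ⌊((k : ℚ) - P.h j) / p⌋ - ⌊((P.h 0 : ℚ) - P.h j - k) / p⌋)

/-- `ν_p = min_{h_{r+1} ≤ k ≤ h₀ − h_{r+1}} ν_{k,p}` of (8.9) (`0` if the range is empty, which the ordering
`h_{r+1} < h₀/2` excludes). [cite: Zudilin2004, §8 (8.9)] -/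
def nuP (P : HParams) (p : ℕ) : ℤ :=
  if hne : (Finset.Icc (P.h (P.r + 1)) (P.h 0 - P.h (P.r + 1))).Nonempty then
    (Finset.Icc (P.h (P.r + 1)) (P.h 0 - P.h (P.r + 1))).inf' hne fun k => P.nuKP k p
  else 0

/-- `Φ(𝐡) = ∏_{√h₀ < p ≤ m_{q−r}} p^{ν_p}` of (8.8) (product over primes `p ≤ m_{q−r}` with `p² > h₀`; `ν_p ≥ 0`).
[cite: Zudilin2004, §8 (8.8)] -/
def Phi (P : HParams) : ℕ :=
  ∏ p ∈ (Finset.range (P.mSeq (P.q - P.r) + 1)).filter (fun p => p.Prime ∧ P.h 0 < p ^ 2),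
    p ^ (P.nuP p).toNat

/-- The `lcm` factor `D_{m₁}^r D_{m₂} ⋯ D_{m_{q−r}}` of Lemma 19 (`D_N = lcm(1,…,N) = Nat.lcmUpto N`).
[cite: Zudilin2004, §8 Lemma 19] -/
def lcmFactor (P : HParams) : ℕ :=
  Nat.lcmUpto (P.mSeq 1) ^ P.r * ∏ j ∈ Finset.Icc 2 (P.q - P.r), Nat.lcmUpto (P.mSeq j)

end HParams

/-- **Zudilin 2004, Lemma 19 (general `𝐡`)** (named fact, statement only; a THEOREM in print — PROVED in the tree at
the parameters of Theorem 3, `Transcendental/ZudilinLemma19.lean`): for odd `q ≥ r+4` and positive integers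
`𝐡 = (h₀;h₁,…,h_q)` with (8.1) and `h₁ ≤ ⋯ ≤ h_q < h₀/2`, the quantity `F(𝐡)` of (8.6) is a linear form in
`1, ζ(r+2), ζ(r+4), …, ζ(q−2)` with rational coefficients, and
`D_{m₁}^r D_{m₂}⋯D_{m_{q−r}} · Φ(𝐡)^{−1} · F(𝐡) ∈ ℤζ(q−2) + ⋯ + ℤζ(r+2) + ℤ` — typed multiplied through by `Φ`:
there are integers `Z₀` and `Z_j` (`j` odd, `r+2 ≤ j ≤ q−2`) with
`D_{m₁}^r D_{m₂}⋯D_{m_{q−r}} · F(𝐡) = Φ(𝐡) · (Z₀ + Σ_j Z_j ζ(j))`.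
[cite: Zudilin2004, §8 Lemma 19 (arXiv:math/0206176 p. 20; J. Théor. Nombres Bordeaux 16 (2004) p. 281)] -/
def lemma19 : Prop :=
  ∀ P : HParams, P.Valid →
    ∃ Z : ℕ → ℤ,
      (P.lcmFactor : ℝ) * P.Fwp =
        (P.Phi : ℝ) * ((Z 0 : ℝ) + ∑ j ∈ (Finset.Icc (P.r + 2) (P.q - 2)).filter Odd, (Z j : ℝ) * zetaValue j)

/-! ### Transcription checks at the parameters of Theorem 3 (`r = 3`, `q = 13`) -/

/-- The parameters of Theorem 3: `h₀ = 91n+2`, `h₁ = h₂ = h₃ = 27n+1`, `h_j = (25+j)n+1` (`4 ≤ j ≤ 13`).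
[cite: Zudilin2004, §8 (8.13) and proof of Theorem 3] -/
def theorem3Params (n : ℕ) : HParams where
  q := 13
  r := 3
  h := fun j => if j = 0 then 91 * n + 2 else if j ≤ 3 then 27 * n + 1 else (25 + j) * n + 1

/-- At the parameters of Theorem 3, `m₀ = 33n`. [cite: Zudilin2004, §8 proof of Theorem 3 (C₂ = 3·35+34+8·33 …)] -/
theorem m0_theorem3Params (n : ℕ) : (theorem3Params n).m0 = 33 * n := by
  simp [HParams.m0, theorem3Params]
  omega

/-- At the parameters of Theorem 3, `(m₁, m₂, m_j) = (35n, 34n, 33n)` (`3 ≤ j ≤ 10`) — the tree's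
`D_{35n}³ D_{34n} D_{33n}⁸`. [cite: Zudilin2004, §8 proof of Theorem 3] -/
theorem mSeq_theorem3Params (n : ℕ) :
    (theorem3Params n).mSeq 1 = 35 * n ∧ (theorem3Params n).mSeq 2 = 34 * n ∧
      ∀ j, 3 ≤ j → j ≤ 10 → (theorem3Params n).mSeq j = 33 * n := by
  refine ⟨?_, ?_, ?_⟩
  · simp [HParams.mSeq, HParams.m0, theorem3Params]; omega
  · simp [HParams.mSeq, HParams.m0, theorem3Params]; omega
  · intro j hj hj'
    have h3 : ¬ (3 + j ≤ 3) := by omega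
    simp [HParams.mSeq, HParams.m0, theorem3Params, h3]
    have : (25 + (3 + j)) * n + 1 ≥ 31 * n + 1 := by nlinarith
    omega

/-- The parameters of Theorem 3 satisfy the standing hypotheses of §8 for `n ≥ 1`.
[cite: Zudilin2004, §8 proof of Theorem 3] -/
theorem valid_theorem3Params {n : ℕ} (hn : 1 ≤ n) : (theorem3Params n).Valid := by
  refine ⟨by show Odd 13; decide, by show Odd 3; decide, by show 3 + 4 ≤ 13; decide, ?_, ?_, ?_, ?_⟩
  · intro j hj
    simp only [theorem3Params]
    split_ifs <;> omega
  · -- (8.1): `2 Σ h_j ≤ h₀ (q − r)`: `2 (3(27n+1) + Σ_{j=4}^{13} ((25+j)n+1)) = 2(416n + 13) ≤ (91n+2)·10`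
    simp only [theorem3Params]
    rw [show Finset.Icc 1 13 = {1,2,3,4,5,6,7,8,9,10,11,12,13} by decide]
    simp
    omega
  · intro j hj
    simp only [theorem3Params, Finset.mem_Icc] at hj ⊢
    split_ifs <;> first | omega | nlinarith
  · simp [theorem3Params]
    omega

end Literature.NumberTheory.Irrationality.Zudilin2004
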